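import Summits.AtomisticToContinuum.FouriersLaw.Theorems.OddSectorIrreversibilityTapLeakBoundBlockConeSite

/-!
# `TapLeakBound` (stmt-AtomisticToContinuum-15159), line `SketchIdeator2`: the deterministic BLOCK light cone of the closed chain

Helper file (`--supports stmt-AtomisticToContinuum-15159`) for crux
P = `Summit.AtomisticToContinuum.FouriersLaw.Theses.OddSectorIrreversibility.TapLeakBound`, registered stub `stub_kickCone`
(C′ `ResampledKickCone`). The stub's open content is an `N`-uniform propagation estimate for the CLOSED pinned FPU-β
chain in Gibbs equilibrium; this file lands its deterministic, `N`-UNIFORM core (companion of `…BlockConePrelim.lean`):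
for two trajectories `Φ_t x`, `Φ_t y` of `detFlow` whose positions stay in the box `|q_k| ≤ R` on the sites `k ≤ L + 1`
of a block during `[0, s]` (the discrepancies `dq_n = |δq_n|`, `dp_n = |δp_n|` are passed as functions with defining
hypotheses — no new definitions):

* `a_le_box` — `a_n = Λ dq_n + dp_n` obeys `a_n(t) ≤ a_n(0) + ∫₀ᵗ (Λ(a_{n-1} + 3a_n) + Λ² dq_{n+1})` for `n ≤ L`;
* `block_cone` — the two-sided geometrically weighted functional `S(t) = Σ_{n ≤ L} θ^{|n-i|} a_n(t)` (`0 < θ ≤ 1`) satisfies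
  `S(t) ≤ (S(0) + 2RΛ² θ^{|L-i|} t) · exp(Λ(4 + 2/θ)t)`: the rest of the chain enters ONLY through the capped source
  `dq_{L+1} ≤ 2R` at the block boundary (generating-function / Grönwall trick), which is what makes the bound uniform in `N`;
* `discrepancy_le_of_box`, `kick_discrepancy_le_of_box` — at the bond site `i ≤ L`: for initial data differing only in
  the contact momentum (the resampled kick of C′), `Λ|δq_i(t)| + |δp_i(t)| ≤ (θ^i |p_0 - p_0'| + 2RΛ²θ^{|L-i|} t) e^{Λ(4+2/θ)t}`
  — the kick is damped by `θ^i`, and optimising `θ⁻¹ ≍ i/(Λ t)` gives the `(eΛt/i)^i`-type cone factor.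

What this does NOT do: control the Gibbs probability of the box event (the maximal inequality for sup-in-time local
energies along the closed flow — the probabilistic half of any cold-cone bound), nor the linear window of the stub.
References: MPPT 1978; BCDM 2007 §3; Raz–Sims 2009 §4; folklore. Nothing here closes the item.
-/

noncomputable section

open MeasureTheory Filter Topology Set Function Metric
open scoped NNReal

namespace Summit.AtomisticToContinuum.FouriersLaw.Theorems.OddSectorIrreversibility.TapLeak

open Literature.MathematicalPhysics.KineticTheory.HeatConduction
open Literature.MathematicalPhysics.KineticTheory

/-! ### §6 The block light cone -/

section Block

open Summit.AtomisticToContinuum.FouriersLaw.Theorems.ClosedConeSensitivity.Negative.ZeroFrictionDictionary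
open Summit.AtomisticToContinuum.FouriersLaw.Theorems.OddSectorIrreversibility.Corrector

variable {ω₂ lam β : ℝ} (hω : 0 < ω₂) (hl : 0 ≤ lam) (hβ : 0 ≤ β) {N : ℕ} (x y : PhaseSpace N)
  (dq dp : ℕ → ℝ → ℝ)
  (hdq : ∀ n τ, dq n τ = if h : n < N then
    |(detFlow ω₂ lam β N τ x).1 ⟨n, h⟩ - (detFlow ω₂ lam β N τ y).1 ⟨n, h⟩| else 0)
  (hdp : ∀ n τ, dp n τ = if h : n < N then
    |(detFlow ω₂ lam β N τ x).2 ⟨n, h⟩ - (detFlow ω₂ lam β N τ y).2 ⟨n, h⟩| else 0)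
include hω hl hβ hdq hdp

/-- **THE BLOCK LIGHT CONE (weighted form).** For two trajectories of the closed pinned chain whose positions stay in
the box `|q_k| ≤ R` on the sites `k ≤ L+1` during `[0, s]`, the two-sided geometrically weighted discrepancy
`S(t) = Σ_{n ≤ L} θ^{|n-i|} (Λ dq_n(t) + dp_n(t))` (`0 < θ ≤ 1`, `i ≤ L`, `Λ ≥ 1`, `Λ² ≥ |ω₂| + 3 lam R²`,
`Λ² ≥ 1 + 12 β R²`) satisfies `S(t) ≤ (S(0) + 2RΛ² θ^{|L-i|} t) · exp(Λ(4 + 2/θ) t)` on `[0, s]` — uniformly in `N`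
(the rest of the chain enters only through the capped source at the block boundary). [folklore] -/
theorem block_cone {R Λ θ : ℝ} {L i : ℕ} {s : ℝ} (hR : 0 ≤ R) (hΛ1 : 1 ≤ Λ)
    (hΛU : |ω₂| + 3 * lam * R ^ 2 ≤ Λ ^ 2) (hΛV : 1 + 12 * β * R ^ 2 ≤ Λ ^ 2) (hθ0 : 0 < θ) (hθ1 : θ ≤ 1)
    (hbox : ∀ τ ∈ Icc 0 s, ∀ (n : ℕ) (h : n < N), n ≤ L + 1 →
      |(detFlow ω₂ lam β N τ x).1 ⟨n, h⟩| ≤ R ∧ |(detFlow ω₂ lam β N τ y).1 ⟨n, h⟩| ≤ R)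
    (a : ℕ → ℝ → ℝ) (ha : ∀ n τ, a n τ = Λ * dq n τ + dp n τ)
    (S : ℝ → ℝ) (hS : ∀ τ, S τ = ∑ n ∈ Finset.range (L + 1), θ ^ Nat.dist n i * a n τ) :
    ∀ t ∈ Icc 0 s, S t ≤ (S 0 + 2 * R * Λ ^ 2 * θ ^ Nat.dist L i * t) * Real.exp (Λ * (4 + 2 * θ⁻¹) * t) := by
  have hΛ0 : 0 ≤ Λ := zero_le_one.trans hΛ1
  have hθ0' : 0 ≤ θ := hθ0.le
  have hθi : 0 ≤ θ⁻¹ := inv_nonneg.2 hθ0'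
  set w : ℕ → ℝ := fun n => θ ^ Nat.dist n i with hw
  have hw0 : ∀ n, 0 ≤ w n := fun n => pow_nonneg hθ0' _
  have hwi : w i = 1 := by simp [hw, Nat.dist_self]
  -- weight steps: `w (n+1) ≤ θ⁻¹ w n` and `w n ≤ θ⁻¹ w (n+1)`
  have hws : ∀ n, w (n + 1) ≤ θ⁻¹ * w n ∧ w n ≤ θ⁻¹ * w (n + 1) := fun n => by
    have h := weight_step hθ0' hθ1 n i
    constructor
    · rw [le_inv_mul_iff₀ hθ0]; exact h.2
    · rw [le_inv_mul_iff₀ hθ0]; exact h.1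
  have hcq : ∀ m, Continuous (dq m) := continuous_dq hω hl hβ x y dq hdq
  have hcp : ∀ m, Continuous (dp m) := continuous_dp hω hl hβ x y dp hdp
  have hca : ∀ m, Continuous (a m) := fun m => by
    have : a m = fun τ => Λ * dq m τ + dp m τ := funext fun τ => ha m τ
    rw [this]; exact ((hcq m).const_mul Λ).add (hcp m)
  have hq0 : ∀ m τ, 0 ≤ dq m τ := dq_nonneg x y dq hdq
  have hp0 : ∀ m τ, 0 ≤ dp m τ := dp_nonneg x y dp hdp
  have ha0 : ∀ m τ, 0 ≤ a m τ := fun m τ => by rw [ha]; have := hq0 m τ; have := hp0 m τ; positivity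
  have hSf : S = fun τ => ∑ n ∈ Finset.range (L + 1), w n * a n τ := funext fun τ => hS τ
  have hScont : Continuous S := by
    rw [hSf]; exact continuous_finsetSum _ fun n _ => (hca n).const_mul _
  have hS0 : ∀ τ, 0 ≤ S τ := fun τ => by
    rw [hS]; exact Finset.sum_nonneg fun n _ => mul_nonneg (hw0 n) (ha0 n τ)
  -- the pointwise bound of the weighted source
  set K : ℝ := Λ * (4 + 2 * θ⁻¹) with hK
  set B : ℝ := 2 * R * Λ ^ 2 * θ ^ Nat.dist L i with hB
  have hK0 : 0 ≤ K := by positivity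
  have hB0 : 0 ≤ B := by positivity
  have hP : ∀ τ ∈ Icc 0 s, ∑ n ∈ Finset.range (L + 1),
      w n * (Λ * (a (n - 1) τ + 3 * a n τ) + Λ ^ 2 * dq (n + 1) τ) ≤ K * S τ + B := by
    intro τ hτ
    -- (P1) the left-shifted sum
    have hP1 : ∑ n ∈ Finset.range (L + 1), w n * a (n - 1) τ ≤ (1 + θ⁻¹) * S τ := by
      rw [Finset.sum_range_succ']
      simp only [Nat.add_sub_cancel, Nat.zero_sub]
      have h1 : ∑ n ∈ Finset.range L, w (n + 1) * a n τ ≤ θ⁻¹ * S τ := by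
        calc ∑ n ∈ Finset.range L, w (n + 1) * a n τ ≤ ∑ n ∈ Finset.range L, θ⁻¹ * w n * a n τ :=
              Finset.sum_le_sum fun n _ => mul_le_mul_of_nonneg_right (hws n).1 (ha0 n τ)
          _ = θ⁻¹ * ∑ n ∈ Finset.range L, w n * a n τ := by
              rw [Finset.mul_sum]; refine Finset.sum_congr rfl fun n _ => by ring
          _ ≤ θ⁻¹ * S τ := by
              refine mul_le_mul_of_nonneg_left ?_ hθi
              rw [hS, Finset.sum_range_succ]
              have := mul_nonneg (hw0 L) (ha0 L τ)
              linarith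
      have h2 : w 0 * a 0 τ ≤ S τ := by
        rw [hS]
        exact Finset.single_le_sum (f := fun n => w n * a n τ) (fun n _ => mul_nonneg (hw0 n) (ha0 n τ))
          (Finset.mem_range.2 (Nat.succ_pos L))
      linarith
    -- (P3) the right-shifted sum with the boundary cap
    have hP3 : Λ ^ 2 * ∑ n ∈ Finset.range (L + 1), w n * dq (n + 1) τ ≤ θ⁻¹ * Λ * S τ + B := by
      rw [Finset.sum_range_succ, mul_add]
      have h1 : Λ ^ 2 * ∑ n ∈ Finset.range L, w n * dq (n + 1) τ ≤ θ⁻¹ * Λ * S τ := by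
        have hterm : ∀ n, Λ ^ 2 * (w n * dq (n + 1) τ) ≤ θ⁻¹ * Λ * (w (n + 1) * a (n + 1) τ) := by
          intro n
          have e : θ⁻¹ * Λ * (w (n + 1) * a (n + 1) τ) =
              Λ * (θ⁻¹ * w (n + 1)) * (Λ * dq (n + 1) τ) + θ⁻¹ * Λ * w (n + 1) * dp (n + 1) τ := by
            rw [ha]; ring
          rw [e]
          have h3 : Λ ^ 2 * (w n * dq (n + 1) τ) = Λ * w n * (Λ * dq (n + 1) τ) := by ring
          rw [h3]
          have h4 : Λ * w n * (Λ * dq (n + 1) τ) ≤ Λ * (θ⁻¹ * w (n + 1)) * (Λ * dq (n + 1) τ) :=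
            mul_le_mul_of_nonneg_right (mul_le_mul_of_nonneg_left (hws n).2 hΛ0)
              (mul_nonneg hΛ0 (hq0 _ _))
          have h5 : 0 ≤ θ⁻¹ * Λ * w (n + 1) * dp (n + 1) τ := by
            have := hw0 (n + 1); have := hp0 (n + 1) τ; positivity
          linarith
        calc Λ ^ 2 * ∑ n ∈ Finset.range L, w n * dq (n + 1) τ
            = ∑ n ∈ Finset.range L, Λ ^ 2 * (w n * dq (n + 1) τ) := Finset.mul_sum _ _ _
          _ ≤ ∑ n ∈ Finset.range L, θ⁻¹ * Λ * (w (n + 1) * a (n + 1) τ) := Finset.sum_le_sum fun n _ => hterm n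
          _ = θ⁻¹ * Λ * ∑ n ∈ Finset.range L, w (n + 1) * a (n + 1) τ := (Finset.mul_sum _ _ _).symm
          _ ≤ θ⁻¹ * Λ * S τ := by
              refine mul_le_mul_of_nonneg_left ?_ (mul_nonneg hθi hΛ0)
              rw [hS, Finset.sum_range_succ']
              have := mul_nonneg (hw0 0) (ha0 0 τ)
              linarith
      have h2 : Λ ^ 2 * (w L * dq (L + 1) τ) ≤ B := by
        rw [hB]
        have hcap := dq_succ_le_two_mul x y dq hdq hR hbox hτ
        have : Λ ^ 2 * (w L * dq (L + 1) τ) = Λ ^ 2 * w L * dq (L + 1) τ := by ring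
        rw [this]
        have h6 : Λ ^ 2 * w L * dq (L + 1) τ ≤ Λ ^ 2 * w L * (2 * R) :=
          mul_le_mul_of_nonneg_left hcap (mul_nonneg (sq_nonneg _) (hw0 L))
        have h7 : Λ ^ 2 * w L * (2 * R) = 2 * R * Λ ^ 2 * θ ^ Nat.dist L i := by simp only [hw]; ring
        linarith
      linarith
    -- assemble
    have hsplit : ∑ n ∈ Finset.range (L + 1), w n * (Λ * (a (n - 1) τ + 3 * a n τ) + Λ ^ 2 * dq (n + 1) τ) =
        Λ * ∑ n ∈ Finset.range (L + 1), w n * a (n - 1) τ + 3 * Λ * S τ +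
          Λ ^ 2 * ∑ n ∈ Finset.range (L + 1), w n * dq (n + 1) τ := by
      rw [hS, Finset.mul_sum, Finset.mul_sum, Finset.mul_sum, ← Finset.sum_add_distrib, ← Finset.sum_add_distrib]
      refine Finset.sum_congr rfl fun n _ => by ring
    rw [hsplit, hK]
    have := mul_le_mul_of_nonneg_left hP1 hΛ0
    nlinarith [hP3, hS0 τ, hθi]
  -- the integral inequality for `S`
  have hmain : ∀ t ∈ Icc 0 s, S t ≤ S 0 + B * t + K * ∫ τ in (0 : ℝ)..t, S τ := by
    intro t ht
    have hg : ∀ n, IntervalIntegrable (fun τ => Λ * (a (n - 1) τ + 3 * a n τ) + Λ ^ 2 * dq (n + 1) τ) volume 0 t :=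
      fun n => ((((hca _).add ((hca _).const_mul 3)).const_mul Λ).add ((hcq _).const_mul _)).intervalIntegrable _ _
    have hstep : S t ≤ S 0 + ∫ τ in (0 : ℝ)..t, ∑ n ∈ Finset.range (L + 1),
        w n * (Λ * (a (n - 1) τ + 3 * a n τ) + Λ ^ 2 * dq (n + 1) τ) := by
      rw [intervalIntegral.integral_finsetSum fun n _ => (hg n).const_mul (w n), hS, hS, ← Finset.sum_add_distrib]
      refine Finset.sum_le_sum fun n hn => ?_
      have hnL : n ≤ L := Nat.lt_succ_iff.1 (Finset.mem_range.1 hn)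
      have h := a_le_box hω hl hβ x y dq dp hdq hdp hΛ1 hΛU hΛV hbox a ha hnL ht
      rw [intervalIntegral.integral_const_mul, ← mul_add]
      exact mul_le_mul_of_nonneg_left h (hw0 n)
    refine hstep.trans ?_
    have hI : ∫ τ in (0 : ℝ)..t, ∑ n ∈ Finset.range (L + 1),
        w n * (Λ * (a (n - 1) τ + 3 * a n τ) + Λ ^ 2 * dq (n + 1) τ) ≤ ∫ τ in (0 : ℝ)..t, (K * S τ + B) := by
      refine intervalIntegral.integral_mono_on ht.1 ?_ ?_ fun τ hτ => hP τ ⟨hτ.1, hτ.2.trans ht.2⟩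
      · exact (continuous_finsetSum _ fun n _ => ((((hca _).add ((hca _).const_mul 3)).const_mul Λ).add
          ((hcq _).const_mul _)).const_mul _).intervalIntegrable _ _
      · exact ((hScont.const_mul K).add continuous_const).intervalIntegrable _ _
    have hI2 : ∫ τ in (0 : ℝ)..t, (K * S τ + B) = K * (∫ τ in (0 : ℝ)..t, S τ) + B * t := by
      rw [intervalIntegral.integral_add ((hScont.const_mul K).intervalIntegrable _ _)
        (continuous_const.intervalIntegrable _ _), intervalIntegral.integral_const_mul,
        intervalIntegral.integral_const, sub_zero, smul_eq_mul]
      ring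
    linarith
  -- Grönwall
  intro t ht
  have := gronwall_affine (hS0 0) hB0 hK0 hScont (fun τ _ => hS0 τ) hmain t ht
  simpa only [hK, hB] using this

/-- **THE BLOCK LIGHT CONE at the bond site.** Under the hypotheses of `block_cone`, the discrepancy at site `i ≤ L`
is bounded by the weighted functional: `Λ dq_i(t) + dp_i(t) ≤ (S(0) + 2RΛ² θ^{|L-i|} t) exp(Λ(4 + 2/θ)t)`, where
`S(0) = Σ_{n ≤ L} θ^{|n-i|}(Λ dq_n(0) + dp_n(0))` only sees the INITIAL discrepancies, damped geometrically in their
distance to `i`. [folklore] -/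
theorem discrepancy_le_of_box {R Λ θ : ℝ} {L i : ℕ} {s : ℝ} (hR : 0 ≤ R) (hΛ1 : 1 ≤ Λ)
    (hΛU : |ω₂| + 3 * lam * R ^ 2 ≤ Λ ^ 2) (hΛV : 1 + 12 * β * R ^ 2 ≤ Λ ^ 2) (hθ0 : 0 < θ) (hθ1 : θ ≤ 1)
    (hiL : i ≤ L)
    (hbox : ∀ τ ∈ Icc 0 s, ∀ (n : ℕ) (h : n < N), n ≤ L + 1 →
      |(detFlow ω₂ lam β N τ x).1 ⟨n, h⟩| ≤ R ∧ |(detFlow ω₂ lam β N τ y).1 ⟨n, h⟩| ≤ R)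
    {t : ℝ} (ht : t ∈ Icc 0 s) :
    Λ * dq i t + dp i t ≤
      ((∑ n ∈ Finset.range (L + 1), θ ^ Nat.dist n i * (Λ * dq n 0 + dp n 0)) +
        2 * R * Λ ^ 2 * θ ^ Nat.dist L i * t) * Real.exp (Λ * (4 + 2 * θ⁻¹) * t) := by
  have h := block_cone hω hl hβ x y dq dp hdq hdp hR hΛ1 hΛU hΛV hθ0 hθ1 hbox (fun n τ => Λ * dq n τ + dp n τ)
    (fun n τ => rfl) (fun τ => ∑ n ∈ Finset.range (L + 1), θ ^ Nat.dist n i * (Λ * dq n τ + dp n τ))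
    (fun τ => rfl) t ht
  refine le_trans ?_ h
  have hq0 : ∀ m τ, 0 ≤ dq m τ := dq_nonneg x y dq hdq
  have hp0 : ∀ m τ, 0 ≤ dp m τ := dp_nonneg x y dp hdp
  have hΛ0 : 0 ≤ Λ := zero_le_one.trans hΛ1
  have := Finset.single_le_sum (f := fun n => θ ^ Nat.dist n i * (Λ * dq n t + dp n t))
    (fun n _ => mul_nonneg (pow_nonneg hθ0.le _) (by have := hq0 n t; have := hp0 n t; positivity))
    (Finset.mem_range.2 (Nat.lt_succ_of_le hiL))
  simpa [Nat.dist_self] using this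


/-- **THE BLOCK LIGHT CONE FOR A MOMENTUM KICK AT THE CONTACT** (the deterministic core of `stub_kickCone`). If the two
initial data differ only in the contact momentum `p_0` (the resampled kick of C′: `y = (q, p[0 ↦ p'])`) and the
positions of both trajectories stay in the box `|q_k| ≤ R` on the sites `k ≤ L + 1` during `[0, s]`, then at the site
`i ≤ L` (distance `i` from the contact), for `t ∈ [0, s]`,
`Λ|δq_i(t)| + |δp_i(t)| ≤ (θ^i |p_0 - p'| + 2RΛ² θ^{|L-i|} t) · exp(Λ(4 + 2/θ)t)`:
geometric damping `θ^i` of the kick and `θ^{|L-i|}` of the capped block boundary (`0 < θ ≤ 1` free; the cone appears on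
optimising `θ⁻¹ ≍ i/(Λt)`), uniformly in `N`. [folklore] -/
theorem kick_discrepancy_le_of_box {R Λ θ : ℝ} {L i : ℕ} {s : ℝ} (hR : 0 ≤ R) (hΛ1 : 1 ≤ Λ)
    (hΛU : |ω₂| + 3 * lam * R ^ 2 ≤ Λ ^ 2) (hΛV : 1 + 12 * β * R ^ 2 ≤ Λ ^ 2) (hθ0 : 0 < θ) (hθ1 : θ ≤ 1)
    (hiL : i ≤ L) (h0 : 0 < N) (p' : ℝ) (hy : y = (x.1, Function.update x.2 ⟨0, h0⟩ p'))
    (hbox : ∀ τ ∈ Icc 0 s, ∀ (n : ℕ) (h : n < N), n ≤ L + 1 →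
      |(detFlow ω₂ lam β N τ x).1 ⟨n, h⟩| ≤ R ∧ |(detFlow ω₂ lam β N τ y).1 ⟨n, h⟩| ≤ R)
    {t : ℝ} (ht : t ∈ Icc 0 s) :
    Λ * dq i t + dp i t ≤
      (θ ^ i * |x.2 ⟨0, h0⟩ - p'| + 2 * R * Λ ^ 2 * θ ^ Nat.dist L i * t) * Real.exp (Λ * (4 + 2 * θ⁻¹) * t) := by
  have h := discrepancy_le_of_box hω hl hβ x y dq dp hdq hdp hR hΛ1 hΛU hΛV hθ0 hθ1 hiL hbox ht
  -- the initial weighted discrepancy is the single kick term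
  have hsum : ∑ n ∈ Finset.range (L + 1), θ ^ Nat.dist n i * (Λ * dq n 0 + dp n 0) = θ ^ i * |x.2 ⟨0, h0⟩ - p'| := by
    have hterm : ∀ n, θ ^ Nat.dist n i * (Λ * dq n 0 + dp n 0) =
        if n = 0 then θ ^ i * |x.2 ⟨0, h0⟩ - p'| else 0 := by
      intro n
      rw [hdq, hdp, detFlow_of_nonpos (ω₂ := ω₂) (lam := lam) (β := β) N le_rfl x,
        detFlow_of_nonpos (ω₂ := ω₂) (lam := lam) (β := β) N le_rfl y]
      by_cases hn : n < N
      · rw [dif_pos hn, dif_pos hn, hy]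
        simp only [sub_self, abs_zero, mul_zero, zero_add]
        by_cases hn0 : n = 0
        · subst hn0
          rw [if_pos rfl]
          have hupd : Function.update x.2 (⟨0, h0⟩ : Fin N) p' ⟨0, hn⟩ = p' := by
            simp
          rw [hupd]
          have hd : Nat.dist 0 i = i := by unfold Nat.dist; omega
          rw [hd]
        · rw [if_neg hn0]
          have hne : (⟨n, hn⟩ : Fin N) ≠ ⟨0, h0⟩ := fun e => hn0 (by simpa using congrArg Fin.val e)
          rw [Function.update_of_ne hne]
          simp
      · rw [dif_neg hn, dif_neg hn]
        have hn0 : n ≠ 0 := by omega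
        rw [if_neg hn0]; ring
    simp_rw [hterm]
    rw [Finset.sum_ite_eq' (Finset.range (L + 1)) 0 (fun _ => θ ^ i * |x.2 ⟨0, h0⟩ - p'|)]
    simp
  rw [hsum] at h
  exact h

end Block


/-! ### Registered sub-goal of the line (closed form of `kick_discrepancy_le_of_box`) -/

/-- **Sub-goal `stub_blockKickCone`** (registered on the crux item for this helper file; closed `∀`-form of
`kick_discrepancy_le_of_box`): the deterministic, `N`-uniform block light cone for a momentum kick at the contact. [folklore] -/
theorem stub_blockKickCone : ∀ (ω₂ lam β : ℝ), 0 < ω₂ → 0 ≤ lam → 0 ≤ β → ∀ (N : ℕ) (x y : PhaseSpace N) (dq dp : ℕ → ℝ → ℝ), (∀ (n : ℕ) (τ : ℝ), dq n τ = if h : n < N then |(Summit.AtomisticToContinuum.FouriersLaw.Theorems.ClosedConeSensitivity.Negative.ZeroFrictionDictionary.detFlow ω₂ lam β N τ x).1 ⟨n, h⟩ - (Summit.AtomisticToContinuum.FouriersLaw.Theorems.ClosedConeSensitivity.Negative.ZeroFrictionDictionary.detFlow ω₂ lam β N τ y).1 ⟨n, h⟩| else 0) → (∀ (n : ℕ)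 (τ : ℝ), dp n τ = if h : n < N then |(Summit.AtomisticToContinuum.FouriersLaw.Theorems.ClosedConeSensitivity.Negative.ZeroFrictionDictionary.detFlow ω₂ lam β N τ x).2 ⟨n, h⟩ - (Summit.AtomisticToContinuum.FouriersLaw.Theorems.ClosedConeSensitivity.Negative.ZeroFrictionDictionary.detFlow ω₂ lam β N τ y).2 ⟨n, h⟩| else 0) → ∀ (R Λ θ : ℝ) (L i : ℕ) (s : ℝ), 0 ≤ R → 1 ≤ Λ → |ω₂| + 3 * lam * R ^ 2 ≤ Λ ^ 2 → 1 + 12 * β * R ^ 2 ≤ Λ ^ 2 → 0 < θ → θ ≤ 1 → i ≤ L → ∀ (h0 : 0 < N) (p' : ℝ), y = (x.1, Function.update x.2 ⟨0, h0⟩ p') → (∀ τ ∈ Set.Icc (0 : ℝ) s, ∀ (n : ℕ) (h : n < N), n ≤ L + 1 → |(Summit.AtomisticToContinuum.FouriersLaw.Theorems.ClosedConeSensitivity.Negative.ZeroFrictionDictionary.detFlow ω₂ lam β N τ x).1 ⟨n, h⟩| ≤ R ∧ |(Summit.AtomisticToContinuum.FouriersLaw.Theorems.ClosedConeSensitivity.Negative.ZeroFrictionDictionary.detFlow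 ω₂ lam β N τ y).1 ⟨n, h⟩| ≤ R) → ∀ (t : ℝ), t ∈ Set.Icc (0 : ℝ) s → Λ * dq i t + dp i t ≤ (θ ^ i * |x.2 ⟨0, h0⟩ - p'| + 2 * R * Λ ^ 2 * θ ^ Nat.dist L i * t) * Real.exp (Λ * (4 + 2 * θ⁻¹) * t) :=
  fun _ _ _ hω hl hβ _ x y dq dp hdq hdp _ _ _ _ _ _ hR hΛ1 hΛU hΛV hθ0 hθ1 hiL h0 p' hy hbox _ ht =>
    kick_discrepancy_le_of_box hω hl hβ x y dq dp hdq hdp hR hΛ1 hΛU hΛV hθ0 hθ1 hiL h0 p' hy hbox ht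

end Summit.AtomisticToContinuum.FouriersLaw.Theorems.OddSectorIrreversibility.TapLeak

end
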